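import Summits.Ventures.DiscreteObjects.Hadamard.InvertingInvolutionWindows668
import Summits.Ventures.DiscreteObjects.Hadamard.Order167InvertingIndexFour668
import Summits.Ventures.DiscreteObjects.Hadamard.CyclicCoreDictionary668

/-!
# H(668): an orbit-preserving involution inverting an element of odd prime order makes the cyclic cores SYMMETRIC
# (uniform kernel dictionary; instances p = 37 with 20 fixed rows, p = 41 with 28 fixed rows)

Framing: lottery ticket; floor = certified bounds/negative ranges.

Cell pub-namedobj (venture DiscreteObjects), target (H), hadamard gen 23; HANDOFF-H-g22 item 4 follow-up (gen 22 did `p = 83`,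
`f = 12`, `Order83SymmetricCore668`).  Gen 19 (`CyclicCorePAF`): for a signed automorphism `σ = (π, κ, d, e)` of an H(668) with
`π^p = κ^p = 1` (`p` an odd prime), a free row `x₀` of the re-signed matrix read along the column cycles gives a family of `±1`
sequences `a_y : ℤ/p → ℤ` (one per moved-column orbit) with `Σ_y PAF_{a_y}(s) = −#Fix κ` for all `s ≠ 0`.  Here, UNIFORMLY in
`p`: if `ρ' = (π', κ', d', e')` INVERTS `σ` (`π'π = π^μ π'`, `κ'κ = κ^μ κ'`, `μ ≡ −1 (mod p)`), maps every moved column into its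
own `σ`-orbit and fixes some `σ`-moved row `x₀`, then the sequences can be chosen SYMMETRIC:
* **`inverting_symmetric_pafFamily`**: ∃ a transversal `T` of the moved columns (`p · |T| = 668 − #Fix κ`) and symmetric `±1`
  sequences `a_y` (`a_y(−t) = a_y(t)`), `y ∈ T`, with `Σ_y PAF_{a_y}(s) = −#Fix κ` (`s ≠ 0`).  [`ρ'` acts on the re-signed matrix
  with signs constant along `σ`-orbits (`signs_const_of_normalizing`); for `κ' y = κ^{c} y` the sequence `u ↦ H'(x₀, κ^u y)` satisfies
  `u(c − t) = η u(t)` with `η = 1` (evaluate at the centre `t = h c`, `h = (p+1)/2 = 2⁻¹`), so its translate by `h c` is symmetric;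
  PAF is translation invariant; the sum is gen 19's `cyclicCore_paf_identity`.]
* instances at the TOP of gen 22's inverting-involution windows (`InvertingInvolutionWindows668`: the top value forces every
  orbit preserved and every `σ`-fixed point fixed, so a `ρ'`-fixed `σ`-moved row exists):
  **`hadamard668_order37_symmetric_pafFamily`** (σ₃₇, an inverting involution with 20 fixed rows ⇒ 18 SYMMETRIC `±1` sequences of
  length 37 with PAF-sum `−2`) and **`hadamard668_order41_symmetric_pafFamily`** (σ₄₁, 28 fixed rows ⇒ 16 symmetric sequences of
  length 41 with PAF-sum `−12`); gen 22's `p = 83` statement is the instance `f = 12` (8 symmetric cores, PAF-sum `−4`).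
STRUCTURE / DICTIONARY of a hypothetical object (one direction; no bordered-array converse claimed); no order excluded; H(668)
untouched.  Ours; no `sorry`, no definitions, default heartbeats.
-/

namespace Summit.Ventures.DiscreteObjects.Hadamard

open Finset BigOperators Matrix

open Literature.Combinatorics.Designs.GoethalsSeidel (IsHadamardMatrix)
open Literature.Combinatorics.Designs.LegendrePairs (PAF IsPM translate PAF_translate)

variable {ι : Type*} [Fintype ι] [DecidableEq ι]

section uniform
variable {H : Matrix ι ι ℤ} (hH : IsHadamardMatrix H) (hι : Fintype.card ι = 668) {p : ℕ} [NeZero p] (hp : p.Prime) (hp2 : p ≠ 2)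
  {π κ π' κ' : Equiv.Perm ι} {d e d' e' : ι → ℤ} (haut : IsSignedAut H π κ d e)
  (hπ : π ^ p = 1) (hκ : κ ^ p = 1)
  (haut' : IsSignedAut H π' κ' d' e') {μ : ℕ} (hnπ : π' * π = π ^ μ * π') (hnκ : κ' * κ = κ ^ μ * κ') (hμ : μ % p = p - 1)
include hH hι hp hp2 haut hπ hκ haut' hnπ hnκ hμ

/-- **Orbit-preserving inversion with a fixed moved row ⇒ SYMMETRIC cyclic cores** (uniform in the odd prime `p`). -/
theorem inverting_symmetric_pafFamily (hcols : ∀ y, κ y ≠ y → κ' y ∈ orbFin κ p y) {x₀ : ι} (hx₀ρ : π' x₀ = x₀)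
    (hx₀π : π x₀ ≠ x₀) :
    ∃ T : Finset ι, p * T.card = 668 - (univ.filter fun y => κ y = y).card ∧
      ∃ a : {y // y ∈ T} → ZMod p → ℤ, (∀ y, IsPM (a y)) ∧ (∀ y t, a y (-t) = a y t) ∧
        ∀ s : ZMod p, s ≠ 0 → ∑ y, PAF (a y) s = -((univ.filter fun y => κ y = y).card : ℤ) := by
  have hodd : Odd p := hp.odd_of_ne_two hp2
  have hfreeR : ∀ j, 0 < j → j < p → (π ^ j) x₀ ≠ x₀ :=
    free_of_fixed_prime_pow π hp (by rw [hπ, Equiv.Perm.one_apply]) hx₀π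
  have hfreeC : ∀ y, κ y ≠ y → ∀ j, 0 < j → j < p → (κ ^ j) y ≠ y :=
    fun y hy => free_of_fixed_prime_pow κ hp (by rw [hκ, Equiv.Perm.one_apply]) hy
  -- re-sign: σ is a permutation automorphism of H'
  obtain ⟨s, t, hs, ht, hH', hinv⟩ := exists_resign_of_odd hH haut hodd hπ hκ
  set H' : Matrix ι ι ℤ := Matrix.of fun i j => s i * t j * H i j with hH'def
  have hinv' : ∀ i j, H' (π i) (κ j) = H' i j := fun i j => by
    simp only [hH'def, Matrix.of_apply]; exact hinv i j
  have hH'ne : ∀ i j, H' i j ≠ 0 := fun i j => pm_ne_zero (hH'.1 i j)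
  -- ρ' on H', signs constant along σ-orbits
  set dρ : ι → ℤ := fun i => s (π' i) * s i * d' i with hdρ
  set eρ : ι → ℤ := fun j => t (κ' j) * t j * e' j with heρ
  have hρ' : IsSignedAut H' π' κ' dρ eρ := signedAut_resign' hs ht haut'
  obtain ⟨-, heκ⟩ := signs_const_of_normalizing hH'ne hinv' hodd hπ hρ' hnπ hnκ x₀
  -- transversal of the moved columns
  set Y := univ.filter fun y => κ y ≠ y with hY
  have hstab : ∀ y ∈ Y, κ y ∈ Y := by
    intro y hy
    rw [hY, Finset.mem_filter] at hy ⊢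
    exact ⟨Finset.mem_univ _, fun h => hy.2 (κ.injective h)⟩
  have hper : ∀ y ∈ Y, (κ ^ p) y = y := fun y _ => by rw [hκ, Equiv.Perm.one_apply]
  have hfreeY : ∀ y ∈ Y, ∀ j, 0 < j → j < p → (κ ^ j) y ≠ y := fun y hy => hfreeC y (Finset.mem_filter.mp hy).2
  obtain ⟨T, hTY, hTcard, hTsum⟩ := exists_free_transversal κ hp.pos Y.card Y le_rfl hstab hper hfreeY
  have hYcard : Y.card = 668 - (univ.filter fun y => κ y = y).card := by
    have hsplit := Finset.card_filter_add_card_filter_not (s := (univ : Finset ι)) (fun y => κ y = y)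
    rw [Finset.card_univ, hι] at hsplit
    have : (univ.filter fun y => ¬ κ y = y).card = 668 - (univ.filter fun y => κ y = y).card := by omega
    exact this
  -- the shift c_y of ρ' on the orbit of y ∈ T
  have hc : ∀ y : {y // y ∈ T}, ∃ c : ℕ, κ' y.1 = (κ ^ c) y.1 := by
    intro y
    obtain ⟨c, -, hc⟩ := Finset.mem_image.mp (hcols y.1 (Finset.mem_filter.mp (hTY y.2)).2)
    exact ⟨c, hc.symm⟩
  choose c hc using hc
  -- arithmetic in ZMod p: μ = −1 and h2 = 2⁻¹
  have hμ' : (μ : ZMod p) = -1 := by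
    rw [← ZMod.natCast_mod μ p, hμ, Nat.cast_sub hp.one_le, ZMod.natCast_self, Nat.cast_one, zero_sub]
  set h2 : ZMod p := (((p + 1) / 2 : ℕ) : ZMod p) with hh2
  have hh : h2 + h2 = 1 := by
    obtain ⟨k, hk⟩ := hodd
    rw [hh2, ← Nat.cast_add, show (p + 1) / 2 + (p + 1) / 2 = p + 1 by omega, Nat.cast_add, ZMod.natCast_self, Nat.cast_one,
      zero_add]
  -- the reflection relation of the untranslated sequences
  have hrefl : ∀ (y : {y // y ∈ T}) (u : ZMod p),
      H' x₀ ((κ ^ ((c y : ZMod p) - u).val) y.1) = dρ x₀ * eρ y.1 * H' x₀ ((κ ^ u.val) y.1) := by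
    intro y u
    have h1 := hρ'.2.2 x₀ ((κ ^ u.val) y.1)
    rw [hx₀ρ, norm_apply_pow hnκ u.val, hc y, ← Equiv.Perm.mul_apply, ← pow_add, heκ] at h1
    have e1 : κ ^ (μ * u.val + c y) = κ ^ ((c y : ZMod p) - u).val := by
      apply pow_eq_pow_of_natCast_eq_n hκ
      rw [ZMod.natCast_zmod_val]; push_cast; rw [ZMod.natCast_zmod_val, hμ']; ring
    rw [e1] at h1
    exact h1
  have hη : ∀ y : {y // y ∈ T}, dρ x₀ * eρ y.1 = 1 := by
    intro y
    have h1 := hrefl y (h2 * (c y : ZMod p))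
    have e2 : (c y : ZMod p) - h2 * (c y : ZMod p) = h2 * (c y : ZMod p) := by
      linear_combination (-(c y : ZMod p)) * hh
    rw [e2] at h1
    have hne0 := hH'ne x₀ ((κ ^ (h2 * (c y : ZMod p)).val) y.1)
    have : (dρ x₀ * eρ y.1 - 1) * H' x₀ ((κ ^ (h2 * (c y : ZMod p)).val) y.1) = 0 := by linarith
    rcases mul_eq_zero.mp this with h9 | h9
    · linarith
    · exact (hne0 h9).elim
  -- the translated sequences
  refine ⟨T, by rw [hTcard, hYcard], fun y => translate (fun u => H' x₀ ((κ ^ u.val) y.1)) (h2 * (c y : ZMod p)),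
    fun y u => hH'.1 _ _, fun y u => ?_, fun s₀ hs₀ => ?_⟩
  · -- symmetry
    show H' x₀ ((κ ^ (-u + h2 * (c y : ZMod p)).val) y.1) = H' x₀ ((κ ^ (u + h2 * (c y : ZMod p)).val) y.1)
    have h1 := hrefl y (u + h2 * (c y : ZMod p))
    rw [hη y, one_mul] at h1
    have e2 : (c y : ZMod p) - (u + h2 * (c y : ZMod p)) = -u + h2 * (c y : ZMod p) := by
      linear_combination (-(c y : ZMod p)) * hh
    rw [e2] at h1
    exact h1
  · -- the autocorrelation sum: translation invariance + the cyclic-core identity of gen 19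
    have hsum : ∑ y : {y // y ∈ T}, PAF (translate (fun u => H' x₀ ((κ ^ u.val) y.1)) (h2 * (c y : ZMod p))) s₀ =
        ∑ y : {y // y ∈ T}, PAF (fun u => H' x₀ ((κ ^ u.val) y.1)) s₀ :=
      Finset.sum_congr rfl fun y _ => PAF_translate _ _ _
    rw [hsum]
    obtain ⟨hs0, hsn⟩ := zmod_val_pos_of_ne_zero hs₀
    have hid := cyclicCore_paf_identity hH' hinv' hπ T hTsum hfreeR hs0 hsn
    rw [← hid, ← Finset.sum_coe_sort T]
    refine Finset.sum_congr rfl fun y _ => ?_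
    unfold PAF
    have hterm : ∀ u : ZMod p, H' x₀ ((κ ^ u.val) y.1) * H' x₀ ((κ ^ (u + s₀).val) y.1) =
        H' x₀ ((κ ^ u.val) y.1) * H' x₀ ((κ ^ (u.val + s₀.val)) y.1) := by
      intro u
      rw [ZMod.val_add, pow_mod_of_pow_eq_one κ hκ]
    simp only [hterm]
    exact sum_zmod_val_eq_sum_range (fun j => H' x₀ ((κ ^ j) y.1) * H' x₀ ((κ ^ (j + s₀.val)) y.1))

end uniform

/-! ### instances at the top of the inverting-involution windows -/

section instances
variable {H : Matrix ι ι ℤ} (hH : IsHadamardMatrix H) (hι : Fintype.card ι = 668)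
  {π κ π' κ' : Equiv.Perm ι} {d e d' e' : ι → ℤ} (haut : IsSignedAut H π κ d e)
  (haut' : IsSignedAut H π' κ' d' e') {μ : ℕ} (hnπ : π' * π = π ^ μ * π') (hnκ : κ' * κ = κ ^ μ * κ')
  (h2 : π' ^ 2 = 1) (h2' : κ' ^ 2 = 1) (hne' : π' ≠ 1 ∨ κ' ≠ 1)
include hH hι haut haut' hnπ hnκ h2 h2' hne'

omit h2 h2' hne' in
/-- a `ρ'`-fixed `σ`-moved row exists as soon as `ρ'` fixes more rows than `σ` does -/
lemma exists_fixed_moved_row {fσ fρ : ℕ} (hσ : (univ.filter fun x => π x = x).card = fσ)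
    (hρ : (univ.filter fun x => π' x = x).card = fρ) (hlt : fσ < fρ) : ∃ x₀, π' x₀ = x₀ ∧ π x₀ ≠ x₀ := by
  have _h := hH; have _h' := hι; have _h'' := haut; have _h3 := haut'; have _h4 := hnπ; have _h5 := hnκ
  by_contra hno
  simp only [not_exists, not_and, ne_eq, not_not] at hno
  have hsub : (univ.filter fun x => π' x = x) ⊆ (univ.filter fun x => π x = x) := by
    intro x hx
    rw [Finset.mem_filter] at hx ⊢
    exact ⟨hx.1, hno x hx.2⟩
  have := Finset.card_le_card hsub
  rw [hσ, hρ] at this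
  omega

/-- **σ₃₇ inverted by an involution with 20 fixed rows ⇒ eighteen SYMMETRIC cyclic cores**: a transversal `T` (`|T| = 18`) and
symmetric `±1` sequences `a_y : ℤ/37 → ℤ`, `y ∈ T`, with `Σ_y PAF_{a_y}(s) = −2` for all `s ≠ 0`. -/
theorem hadamard668_order37_symmetric_pafFamily (hπ : π ^ 37 = 1) (hκ : κ ^ 37 = 1) (hne : π ≠ 1 ∨ κ ≠ 1) (hμ : μ % 37 = 36)
    (h20 : (univ.filter fun x => π' x = x).card = 20) :
    ∃ T : Finset ι, T.card = 18 ∧ ∃ a : {y // y ∈ T} → ZMod 37 → ℤ, (∀ y, IsPM (a y)) ∧ (∀ y t, a y (-t) = a y t) ∧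
      ∀ s : ZMod 37, s ≠ 0 → ∑ y, PAF (a y) s = -2 := by
  have h37 := hadamard668_fixedRows_37 hH hι π κ d e haut hπ hκ hne
  obtain ⟨-, -, himp⟩ := hadamard668_order37_inverting_involution hH hι haut haut' hnπ hnκ h2 h2' hne' hπ hκ hne hμ
  obtain ⟨-, -, hcols, -⟩ := himp h20
  obtain ⟨x₀, hx₀ρ, hx₀π⟩ := exists_fixed_moved_row hH hι haut haut' hnπ hnκ h37.1 h20 (by norm_num)
  obtain ⟨T, hTcard, a, hpm, hsym, hpaf⟩ := inverting_symmetric_pafFamily hH hι (by norm_num : Nat.Prime 37) (by norm_num)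
    haut hπ hκ haut' hnπ hnκ (by rw [hμ]) hcols hx₀ρ hx₀π
  rw [h37.2] at hTcard hpaf
  exact ⟨T, by omega, a, hpm, hsym, fun s hs => by rw [hpaf s hs]; norm_num⟩

/-- **σ₄₁ inverted by an involution with 28 fixed rows ⇒ sixteen SYMMETRIC cyclic cores**: `|T| = 16`, symmetric `±1` sequences
`a_y : ℤ/41 → ℤ` with `Σ_y PAF_{a_y}(s) = −12` for all `s ≠ 0`. -/
theorem hadamard668_order41_symmetric_pafFamily (hπ : π ^ 41 = 1) (hκ : κ ^ 41 = 1) (hne : π ≠ 1 ∨ κ ≠ 1) (hμ : μ % 41 = 40)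
    (h28 : (univ.filter fun x => π' x = x).card = 28) :
    ∃ T : Finset ι, T.card = 16 ∧ ∃ a : {y // y ∈ T} → ZMod 41 → ℤ, (∀ y, IsPM (a y)) ∧ (∀ y t, a y (-t) = a y t) ∧
      ∀ s : ZMod 41, s ≠ 0 → ∑ y, PAF (a y) s = -12 := by
  have h41 := hadamard668_fixedRows_41 hH hι π κ d e haut hπ hκ hne
  obtain ⟨-, -, himp⟩ := hadamard668_order41_inverting_involution hH hι haut haut' hnπ hnκ h2 h2' hne' hπ hκ hne hμ
  obtain ⟨-, -, hcols, -⟩ := himp h28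
  obtain ⟨x₀, hx₀ρ, hx₀π⟩ := exists_fixed_moved_row hH hι haut haut' hnπ hnκ h41.1 h28 (by norm_num)
  obtain ⟨T, hTcard, a, hpm, hsym, hpaf⟩ := inverting_symmetric_pafFamily hH hι (by norm_num : Nat.Prime 41) (by norm_num)
    haut hπ hκ haut' hnπ hnκ (by rw [hμ]) hcols hx₀ρ hx₀π
  rw [h41.2] at hTcard hpaf
  exact ⟨T, by omega, a, hpm, hsym, fun s hs => by rw [hpaf s hs]; norm_num⟩

end instances

end Summit.Ventures.DiscreteObjects.Hadamard
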